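import Mathlib
import Summits.CriticalPhenomena.SAWScalingLimit.Theorems.SAWDefectDecoherenceObservableToSLERGateTransferLowerLevels
import Summits.CriticalPhenomena.SAWScalingLimit.Theorems.SAWDefectDecoherenceObservableToSLERGateTransferCells

/-!
# Gate transfer, sides 3: the cell structure holds eventually

Support file for the stub `stub_gateTransfer` (the gate transfer
`GateDecomposition → RenewalAccumulation → CarvedToSLE → HexTight → FullIdentification`) of the
line `bridge-gate-renewal` for the crux
`Summit.CriticalPhenomena.SAWScalingLimit.Theses.SAWDefectDecoherence.ObservableToSLER`
(item `stmt-CriticalPhenomena-14005`).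

* `gateSide_subset_closedBall` — the root side of a single-crossing gate is small when the walk
  ends far away (short-arc argument, `connectedComponentIn_subset_closedBall`);
* `eventually_productCell` (registered sub-goal `stub_eventuallyProductCell`) — for a Dobrushin
  domain with an endpoint approximation there is `R₁ > 0` such that for all windows `[r, R]`,
  `R ≤ R₁`, all window radii and all small meshes, every critical SAW lies in a product cell with
  prefix/suffix diameter bound `16 R`: the two root sides are small hence disjoint, prefix and
  suffix lie in them, and the first good gates do not depend on the middle piece.
-/

noncomputable section

open scoped BigOperators Topology NNReal ENNReal Classical BoundedContinuousFunction unitInterval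
open Filter Set MeasureTheory Metric

namespace Summit.CriticalPhenomena.SAWScalingLimit.Theorems.ObservableToSLER.BridgeGate

open Literature.Probability.LatticeModels (HexVertex hexGraph hexCenter triZeta Site polyline)
open Literature.Probability.RandomPlanarGeometry
open Literature.Probability.RandomPlanarGeometry.SAW
open Summit.CriticalPhenomena.SAWScalingLimit.Theorems.ObservableToSLE.Negative
  (mem_embMeshDomain_of_mem_support_tail)

section ProductCells

/-- The two marked points of a Dobrushin domain are distinct. -/
theorem DobrushinDomain_pt_ne (D : DobrushinDomain) : D.pt 0 ≠ D.pt 1 := by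
  intro h
  have h0 := D.mark_mem 0
  have h1 := D.mark_mem 1
  have hlt : D.mark 0 < D.mark 1 := D.strictMono_mark (by decide)
  have := D.injOn_boundary h0 h1 h
  exact hlt.ne this

/-- **The root side of a single-crossing gate is small** when the walk ends far away: it lies in
the ball of radius `ρ₁ + η` about the rescaled root, if the level hexagon lies in the ball of
radius `ρ₁`, boundary points in the hexagon cut off `η`-short arcs, and the final vertex is
farther than `ρ₁ + η`. -/
theorem gateSide_subset_closedBall (D : DobrushinDomain) {δ : ℝ} (hδ : 0 < δ) {c e : HexVertex}
    {k j : ℕ} {u v : HexVertex} (w : (hexDomainGraph D.carrier δ).Walk c e)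
    (hfe : IsFirstExit c k w.support j u v)
    (hsc : ∀ x ∈ w.support.drop j, x ∉ sideVerts D.carrier δ c k u v) {ρ₁ η : ℝ} (hη : 0 ≤ η)
    (hK : contHex δ c k ⊆ closedBall ((δ : ℂ) * hexCenter c) ρ₁)
    (hz : ∃ z₁ z₂ : ℂ, z₁ ∈ frontier (contHex δ c k) ∧ z₁ ∉ D.carrier ∧
      z₂ ∈ frontier (contHex δ c k) ∧ z₂ ∉ D.carrier ∧ z₁ ≠ z₂)
    (harc : ∀ s t : ℝ, s < t → t < s + 1 → D.boundary s ∈ contHex δ c k →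
      D.boundary t ∈ contHex δ c k →
      (∀ u ∈ Icc s t, dist (D.boundary u) (D.boundary s) < η) ∨
      (∀ u ∈ Icc t (s + 1), dist (D.boundary u) (D.boundary s) < η))
    (hfar : ρ₁ + η < dist ((δ : ℂ) * hexCenter e) ((δ : ℂ) * hexCenter c)) :
    gateSide D.carrier δ c k u v ⊆ closedBall ((δ : ℂ) * hexCenter c) (ρ₁ + η) := by
  obtain ⟨z₁, z₂, hz₁, hz₁D, hz₂, hz₂D, hne⟩ := hz
  have hg := gatePoint_mem_of_single_crossing D.isConnected w hfe hsc
  have hnil := not_nil_of_isFirstExit w hfe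
  have hcutK : gateCut D.carrier δ c k u v ⊆ frontier (contHex δ c k) :=
    (connectedComponentIn_subset _ _).trans inter_subset_left
  have heL : e ∈ w.support.drop j := by
    have := hfe.getLast_mem_drop w.support_ne_nil
    rwa [w.getLast_support] at this
  exact connectedComponentIn_subset_closedBall D.toJordanDomain (convex_contHex δ c k)
    (interior_contHex_nonempty hδ c k)
    (isBounded_closedBall.subset (contHex_subset_closedBall hδ c k)) (isClosed_contHex δ c k)
    hg.1 hg.2 hz₁ hz₁D hz₂ hz₂D hne rfl hη hK harc
    ⟨mem_of_mem_support w hnil hfe.fst_mem, fun h => hexCenter_not_mem_frontier hδ u (hcutK h)⟩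
    ⟨mem_of_mem_support w hnil (List.mem_of_mem_drop heL),
      fun h => hexCenter_not_mem_frontier hδ e (hcutK h)⟩
    (hsc e heL) hfar

/-- **THE CELL STRUCTURE, EVENTUALLY** (the topological content of the gate transfer): for a
Dobrushin domain with an endpoint approximation there is `R₁ > 0` such that for every window
`[r, R]` with `R ≤ R₁`, every window radius, and all small meshes, the cell of every critical
SAW through its first good gates is a product cell with prefix/suffix diameter bound `16 R`
(`productCell`): the two root sides are small (short-arc argument) hence disjoint, the prefix
and suffix lie in them (`take_subset_sideVerts`), and the first good gates do not depend on the
middle piece (`isFirstGoodGate_of_prefix`). -/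
theorem eventually_productCell (D : DobrushinDomain) (a b : ℝ → HexVertex)
    (hab : IsEmbEndpointApprox hexGraph hexCenter D a b) :
    ∃ R₁ > (0 : ℝ), ∀ R ∈ Set.Ioc (0 : ℝ) R₁, ∀ r ∈ Set.Ioo (0 : ℝ) R, ∀ ρ > (0 : ℝ),
      ∀ᶠ δ : ℝ in 𝓝[>] 0, ∀ γ₀ : HexDomainSAW D.carrier δ (a δ) (b δ),
        γ₀ ∈ productCell D.carrier δ r R ρ (a δ) (b δ) (16 * R) := by
  set za := D.pt 0 with hza
  set zb := D.pt 1 with hzb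
  set d := dist za zb with hd
  have hd0 : 0 < d := dist_pos.2 (DobrushinDomain_pt_ne D)
  have hzaF : za ∈ frontier D.carrier := D.boundary_mem_frontier _
  have hzbF : zb ∈ frontier D.carrier := D.boundary_mem_frontier _
  obtain ⟨lam, hlam, harc⟩ := exists_short_arc D.toJordanDomain (η := d / 8) (by positivity)
  refine ⟨min (d / 64) (lam / 16), by positivity, ?_⟩
  rintro R ⟨hR0, hR1⟩ r ⟨hr0, hrR⟩ ρ _
  have hRd : R ≤ d / 64 := hR1.trans (min_le_left _ _)
  have hRl : R ≤ lam / 16 := hR1.trans (min_le_right _ _)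
  have hε : 0 < min (r / 2) (d / 8) := by positivity
  have hA := Metric.tendsto_nhds.1 hab.tendsto_fst _ hε
  have hB := Metric.tendsto_nhds.1 hab.tendsto_snd _ hε
  have hsmall : ∀ᶠ δ : ℝ in 𝓝[>] 0, δ < min R (d / 16) :=
    (eventually_lt_nhds (by positivity : (0 : ℝ) < min R (d / 16))).filter_mono nhdsWithin_le_nhds
  filter_upwards [hA, hB, hsmall, self_mem_nhdsWithin] with δ hAδ hBδ hδs hδ0
  replace hδ0 : 0 < δ := hδ0
  have hδR : δ < R := hδs.trans_le (min_le_left _ _)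
  have hδd : δ < d / 16 := hδs.trans_le (min_le_right _ _)
  have hAd : dist ((δ : ℂ) * hexCenter (a δ)) za < d / 8 := hAδ.trans_le (min_le_right _ _)
  have hBd : dist ((δ : ℂ) * hexCenter (b δ)) zb < d / 8 := hBδ.trans_le (min_le_right _ _)
  have hab' : 3 * d / 4 < dist ((δ : ℂ) * hexCenter (a δ)) ((δ : ℂ) * hexCenter (b δ)) := by
    have := dist_triangle4 za ((δ : ℂ) * hexCenter (a δ)) ((δ : ℂ) * hexCenter (b δ)) zb
    linarith [dist_comm za ((δ : ℂ) * hexCenter (a δ))]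
  -- geometry of a level hexagon around an endpoint
  have geom : ∀ (c : HexVertex) (k : ℕ) (zc zf : ℂ), r ≤ k * δ → k * δ ≤ R →
      dist ((δ : ℂ) * hexCenter c) zc < min (r / 2) (d / 8) → d ≤ dist zc zf →
      zc ∈ frontier D.carrier → zf ∈ frontier D.carrier →
      contHex δ c k ⊆ closedBall ((δ : ℂ) * hexCenter c) (6 * R) ∧
      (∃ z₁ z₂ : ℂ, z₁ ∈ frontier (contHex δ c k) ∧ z₁ ∉ D.carrier ∧
        z₂ ∈ frontier (contHex δ c k) ∧ z₂ ∉ D.carrier ∧ z₁ ≠ z₂) ∧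
      (∀ s t : ℝ, s < t → t < s + 1 → D.boundary s ∈ contHex δ c k → D.boundary t ∈ contHex δ c k →
        (∀ u ∈ Icc s t, dist (D.boundary u) (D.boundary s) < d / 8) ∨
        (∀ u ∈ Icc t (s + 1), dist (D.boundary u) (D.boundary s) < d / 8)) := by
    intro c k zc zf hrk hkR hc hcf hzc hzf
    have hcr : dist ((δ : ℂ) * hexCenter c) zc < r / 2 := hc.trans_le (min_le_left _ _)
    have hcd : dist ((δ : ℂ) * hexCenter c) zc < d / 8 := hc.trans_le (min_le_right _ _)
    have hK : contHex δ c k ⊆ closedBall ((δ : ℂ) * hexCenter c) (6 * R) :=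
      (contHex_subset_closedBall hδ0 c k).trans (closedBall_subset_closedBall (by nlinarith))
    refine ⟨hK, ?_, ?_⟩
    · refine exists_two_frontier_points D.toJordanDomain (isClosed_contHex δ c k) hzc ?_ hzf ?_
      · refine openHex_subset_interior (ball_subset_openHex hδ0 c k ?_)
        rw [mem_ball]
        have : r / 2 ≤ k * δ / 2 := by linarith
        linarith [dist_comm ((δ : ℂ) * hexCenter c) zc]
      · intro h
        have h1 := hK h
        rw [mem_closedBall] at h1
        have := dist_triangle_right zc zf ((δ : ℂ) * hexCenter c)
        linarith [dist_comm ((δ : ℂ) * hexCenter c) zc]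
    · intro s t hst hts hs ht
      refine harc s t hst hts ?_
      have h1 := hK hs
      have h2 := hK ht
      rw [mem_closedBall] at h1 h2
      have := dist_triangle_right (D.boundary s) (D.boundary t) ((δ : ℂ) * hexCenter c)
      linarith
  -- the walk and its first good gates
  intro γ₀ n m p q n' m' p' q' hfa hfb
  set L₀ := γ₀.walk.support with hL₀
  have hrev : γ₀.walk.reverse.support = L₀.reverse := SimpleGraph.Walk.support_reverse _
  have hfb' : IsFirstGoodGate D.carrier δ r R ρ (b δ) γ₀.walk.reverse.support n' m' p' q' := by
    rwa [hrev]
  have hfea : IsFirstExit (a δ) n L₀ m p q := hfa.1.2.2.1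
  have hfeb : IsFirstExit (b δ) n' γ₀.walk.reverse.support m' p' q' := hfb'.1.2.2.1
  have hm := hfea.pos
  have hml := hfea.lt_length
  have hm' := hfeb.pos
  have hml' : m' < L₀.length := by have := hfeb.lt_length; rwa [hrev, List.length_reverse] at this
  obtain ⟨hKa, hza', harca⟩ := geom (a δ) n za zb hfa.1.1 hfa.1.2.1 hAδ le_rfl hzaF hzbF
  obtain ⟨hKb, hzb', harcb⟩ := geom (b δ) n' zb za hfb.1.1 hfb.1.2.1 hBδ (by rw [dist_comm])
    hzbF hzaF
  -- the prefix and the suffix lie in the root sides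
  have hSa : ∀ v ∈ L₀.take m, v ∈ sideVerts D.carrier δ (a δ) n p q :=
    take_subset_sideVerts D hδ0 hza' γ₀.walk hfea
  have hTb : ∀ v ∈ L₀.drop (L₀.length - m'), v ∈ sideVerts D.carrier δ (b δ) n' p' q' := by
    intro v hv
    rw [mem_drop_length_sub_iff, ← hrev] at hv
    exact take_subset_sideVerts D hδ0 hzb' γ₀.walk.reverse hfeb v hv
  -- the root sides are small, hence disjoint
  have hd8 : (0 : ℝ) ≤ d / 8 := by positivity
  have hUa : gateSide D.carrier δ (a δ) n p q ⊆ closedBall ((δ : ℂ) * hexCenter (a δ)) (6 * R + d / 8) :=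
    gateSide_subset_closedBall D hδ0 γ₀.walk hfea hfa.1.2.2.2.1 hd8 hKa hza' harca
      (by rw [dist_comm]; linarith)
  have hUb : gateSide D.carrier δ (b δ) n' p' q' ⊆ closedBall ((δ : ℂ) * hexCenter (b δ)) (6 * R + d / 8) :=
    gateSide_subset_closedBall D hδ0 γ₀.walk.reverse hfeb hfb'.1.2.2.2.1 hd8 hKb hzb' harcb
      (by linarith)
  have hST : Disjoint (sideVerts D.carrier δ (a δ) n p q) (sideVerts D.carrier δ (b δ) n' p' q') := by
    refine Set.disjoint_left.2 fun v hva hvb => ?_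
    have h1 := hUa hva
    have h2 := hUb hvb
    rw [mem_closedBall] at h1 h2
    have := dist_triangle_left ((δ : ℂ) * hexCenter (a δ)) ((δ : ℂ) * hexCenter (b δ)) ((δ : ℂ) * hexCenter v)
    linarith
  -- vertices and adjacencies
  have hnil : ¬ γ₀.walk.Nil := not_nil_of_isFirstExit _ hfea
  have hΩ : ∀ x ∈ L₀, (δ : ℂ) * hexCenter x ∈ D.carrier := fun x hx => mem_of_mem_support _ hnil hx
  have hpq : (hexDomainGraph D.carrier δ).Adj p q := hfea.adj γ₀.walk
  have hp'q' : (hexDomainGraph D.carrier δ).Adj p' q' := hfeb.adj γ₀.walk.reverse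
  have hpS : p ∈ sideVerts D.carrier δ (a δ) n p q := hSa p hfea.fst_mem_take
  have hp'T : p' ∈ sideVerts D.carrier δ (b δ) n' p' q' := by
    refine hTb p' ?_
    rw [mem_drop_length_sub_iff, ← hrev]
    exact hfeb.fst_mem_take
  -- the middle piece is nonempty
  have hq := hfea.getElem?_eq
  have hlen : m + m' < L₀.length := by
    by_contra hle
    push Not at hle
    rcases hle.lt_or_eq with hlt | heq
    · -- `p` would lie in both root sides
      have hpT : p ∈ L₀.drop (L₀.length - m') := List.mem_iff_getElem?.2 ⟨m - 1 - (L₀.length - m'), by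
        rw [List.getElem?_drop, show L₀.length - m' + (m - 1 - (L₀.length - m')) = m - 1 by omega]
        exact hfea.getElem?_pred_eq⟩
      exact Set.disjoint_left.1 hST hpS (hTb p hpT)
    · -- `q` would lie in the far root side, next to `p`
      have hqT : q ∈ L₀.drop (L₀.length - m') := List.mem_iff_getElem?.2 ⟨0, by
        rw [List.getElem?_drop, show L₀.length - m' + 0 = m by omega]; exact hq⟩
      have h1 := hUa hpS
      have h2 := hUb (hTb q hqT)
      rw [mem_closedBall] at h1 h2
      have hadj : dist ((δ : ℂ) * hexCenter p) ((δ : ℂ) * hexCenter q) ≤ δ * 4 := by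
        have hk := abs_rowCoord_sub_le_one_of_adj ((adj_hexDomainGraph_iff).1 hpq).1.1
        have h := dist_hexCenter_le (v := p) (w := q) (k := 1) (by exact_mod_cast hk 0)
          (by exact_mod_cast hk 1)
        rw [dist_eq_norm] at h ⊢
        rw [← mul_sub, norm_mul, Complex.norm_real, Real.norm_eq_abs, abs_of_pos hδ0]
        nlinarith
      have := dist_triangle4 ((δ : ℂ) * hexCenter (a δ)) ((δ : ℂ) * hexCenter p)
        ((δ : ℂ) * hexCenter q) ((δ : ℂ) * hexCenter (b δ))
      linarith [dist_comm ((δ : ℂ) * hexCenter p) ((δ : ℂ) * hexCenter (a δ))]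
  -- the walks of the prefix and of the suffix
  have hw₁ := exists_walk_take γ₀.walk γ₀.isPath hfea.1
  have hhead' : (L₀.drop (L₀.length - m')).head? = some p' := by
    have := hfeb.1
    rwa [hrev, List.take_reverse, List.getLast?_reverse] at this
  have hw₂ := exists_walk_drop γ₀.walk γ₀.isPath hhead'
  -- distance bounds
  have hbound : ∀ {c : HexVertex} {k : ℕ} {u v x : HexVertex}, x ∈ hexBall c k → u ∈ hexBall c k →
      hexGraph.Adj u v → (k : ℝ) * δ ≤ R →
      dist ((δ : ℂ) * hexCenter x) ((δ : ℂ) * hexCenter v) ≤ 16 * R := by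
    intro c k u v x hx hu huv hk
    have := dist_hexCenter_le_of_mem_hexBall_of_adj hδ0 hx hu huv
    nlinarith
  refine ⟨hST, ?_, ?_, hpq, hp'q'.symm, hlen, ?_, ?_, ?_⟩
  · obtain ⟨w₁, hw₁p, hw₁s⟩ := hw₁
    exact ⟨w₁, hw₁p, hw₁s, hSa⟩
  · obtain ⟨w₂, hw₂p, hw₂s⟩ := hw₂
    exact ⟨w₂, hw₂p, hw₂s, hTb⟩
  · -- the transfer of the first good gates
    intro γ mid hh hl hav hsupp
    have hmid : mid ≠ [] := by rintro rfl; simp at hh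
    constructor
    · refine isFirstGoodGate_of_prefix D hδ0 γ₀.walk γ.walk hfa hza'
        (rest := mid ++ L₀.drop (L₀.length - m')) (by rw [hsupp, List.append_assoc]) ?_ ?_
      · rw [List.head?_append, hh]; rfl
      · intro v hv
        rw [List.mem_append] at hv
        rcases hv with hv | hv
        · exact (hav v hv).1
        · exact fun h => Set.disjoint_left.1 hST h (hTb v hv)
    · have hrevγ : γ.walk.reverse.support = γ.walk.support.reverse := SimpleGraph.Walk.support_reverse _
      rw [← hrevγ]
      refine isFirstGoodGate_of_prefix D hδ0 γ₀.walk.reverse γ.walk.reverse hfb' hzb'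
        (rest := mid.reverse ++ (L₀.take m).reverse) ?_ ?_ ?_
      · rw [hrevγ, hsupp, hrev, List.take_reverse, List.reverse_append, List.reverse_append]
      · rw [List.head?_append, List.head?_reverse, hl]; rfl
      · intro v hv
        rw [List.mem_append, List.mem_reverse, List.mem_reverse] at hv
        rcases hv with hv | hv
        · exact (hav v hv).2
        · exact fun h => Set.disjoint_left.1 hST (hSa v hv) h
  · intro x hx
    exact hbound (hfea.2.2.1 x hx) (hfea.2.2.1 p hfea.fst_mem_take)
      ((adj_hexDomainGraph_iff).1 hpq).1.1 hfa.1.2.1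
  · intro x hx
    rw [mem_drop_length_sub_iff, ← hrev] at hx
    exact hbound (hfeb.2.2.1 x hx) (hfeb.2.2.1 p' hfeb.fst_mem_take)
      ((adj_hexDomainGraph_iff).1 hp'q').1.1 hfb.1.2.1

end ProductCells

end Summit.CriticalPhenomena.SAWScalingLimit.Theorems.ObservableToSLER.BridgeGate

namespace Summit.CriticalPhenomena.SAWScalingLimit.Theorems.ObservableToSLER.BridgeGate

open Literature.Probability.LatticeModels (HexVertex hexGraph hexCenter triZeta Site)
open Literature.Probability.RandomPlanarGeometry
open Literature.Probability.RandomPlanarGeometry.SAW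

/-- **Registered sub-goal `stub_eventuallyProductCell`** (self-contained form of `eventually_productCell`). -/
theorem stub_eventuallyProductCell : ∀ (D : DobrushinDomain) (a b : ℝ → HexVertex), IsEmbEndpointApprox hexGraph hexCenter D a b → ∃ R₁ > (0 : ℝ), ∀ R ∈ Set.Ioc (0 : ℝ) R₁, ∀ r ∈ Set.Ioo (0 : ℝ) R, ∀ ρ > (0 : ℝ), ∀ᶠ δ : ℝ in 𝓝[>] 0, ∀ γ₀ : HexDomainSAW D.carrier δ (a δ) (b δ), γ₀ ∈ productCell D.carrier δ r R ρ (a δ) (b δ) (16 * R) :=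
  fun D a b hab => eventually_productCell D a b hab

end Summit.CriticalPhenomena.SAWScalingLimit.Theorems.ObservableToSLER.BridgeGate

end
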